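import Mathlib
import Summits.ResolutionOfSingularities.ResolutionOfSingularities.Theorems.RadicialJungCleanModelsCleanLU3ArcPrelims
import HarnessLib

/-!
# Route `RadicialJung`, crux `CleanModels` (stmt-15917), stub `stub_cleanLU3DefectNonDiscrete`, sub-line (C-div): a derivation with BOUNDED
# DENOMINATORS on a discrete rank-one valuation ring forbids `v`-adic limits of `p`-th powers — Step 0 of the lead's memo
# `Cruxes/CleanModels/Lines/Sketch-memo-nondiscrete-classC.md`

Line `Sketch` rev 24 of crux stmt-ResolutionOfSingularities-15917; lead `res-B-lead-1` g3.  OURS; nothing here proves resolution in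
characteristic `p`.  For a COMPOSITE valuation `v = v₁ ∘ v₂` with divisorial coarsening `v₁ = ord_E`, the valuation ring `O₁` of `v₁` is a
localisation of the model, so the absolute derivation `D` of LEMMA D-abs (✓ `Lens5.AbsDerivation.absDerivation_of_forall_pow_ne'`: `D g₀ ≠ 0`,
`s • D` preserves the model) satisfies `s • D(O₁) ⊆ O₁`; this file shows that then `g₀` HAS a best `p`-th-power approximation for `v₁` (the
`v₁`-adic improvement terminates), in contrast with the zero-dimensional `O` of class (A), on which `D` is never `v`-continuous (res-B-lens-5 g7,
sizing memo §3.5).  Mechanism: `D` kills `p`-th powers, and `s·D(π^N r′) = π^{N-1}(N s Dπ · r′ + π · s D r′) ∈ π^{N-1} O₁`, so arbitrarily good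
approximations `g₀ - f^p ∈ π^N O₁` (✓ `exists_approx_le_pow_of_forall_exists_lt`) force `v₁(s D g₀) ≥ N - 1` for every `N`, i.e. `D g₀ = 0`.

* `valuation_mul_derivation_pow_mul_le` — the continuity estimate `v (s · D (π^N · r′)) ≤ v(π)^(N-1)` for `r′ ∈ O₁`.
* `derivation_eq_zero_of_forall_approx` — if `g₀ - f^p` can be made divisible by every power of `π`, then `D g₀ = 0`.
* `exists_best_pthPowerApprox_of_derivation` — hence, if `D g₀ ≠ 0`, some `a` approximates `g₀` at least as well as every `b`:
  `v (g₀ - a^p) ≤ v (g₀ - b^p)` (multiplicative valuation: smaller is deeper).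
* `bestApprox_dichotomy` — at a best approximation, `g₀ - a^p` is ramified (its value is no `p`-th-power value; on a discrete ring:
  `v = v(π)^m`, `p ∤ m`, `valuation_eq_pow_not_dvd_of_forall_ne`) or inert (`= c^p · u`, `u` a unit residually not a `p`-th power) — Step 1.
-/

noncomputable section

set_option linter.dupNamespace false -- mandated namespace of this single-conjunct summit

namespace Summit.ResolutionOfSingularities.ResolutionOfSingularities.Theorems.RadicialJung.CleanModels

variable {K : Type} [Field K]

/-- **Continuity estimate**: if `s • D` preserves `O`, then `v (s · D (π ^ N · r′)) ≤ v(π) ^ (N - 1)` for `π, r′ ∈ O`, `N ≥ 1`. [folklore] -/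
theorem valuation_mul_derivation_pow_mul_le (O : ValuationSubring K) (D : Derivation ℤ K K) (s : K)
    (hD : ∀ y : K, y ∈ O → s * D y ∈ O) (π : K) (hπO : π ∈ O) (r' : K) (hr' : r' ∈ O) (N : ℕ) (hN : 1 ≤ N) :
    O.valuation (s * D (π ^ N * r')) ≤ O.valuation π ^ (N - 1) := by
  obtain ⟨M, rfl⟩ : ∃ M, N = M + 1 := ⟨N - 1, (Nat.sub_add_cancel hN).symm⟩
  rw [Nat.add_sub_cancel]
  have hvπ : O.valuation π ≤ 1 := (O.valuation_le_one_iff _).mpr hπO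
  have hvr : O.valuation r' ≤ 1 := (O.valuation_le_one_iff _).mpr hr'
  have hDπ : O.valuation (s * D π) ≤ 1 := (O.valuation_le_one_iff _).mpr (hD π hπO)
  have hDr : O.valuation (s * D r') ≤ 1 := (O.valuation_le_one_iff _).mpr (hD r' hr')
  have hnat : O.valuation ((M + 1 : ℕ) : K) ≤ 1 := (O.valuation_le_one_iff _).mpr (natCast_mem O (M + 1))
  -- `D (π^(M+1) r') = (M+1) π^M Dπ · r' + π^(M+1) D r'`
  have hexp : s * D (π ^ (M + 1) * r') =
      π ^ M * (((M + 1 : ℕ) : K) * (s * D π) * r' + π * (s * D r')) := by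
    rw [Derivation.leibniz, Derivation.leibniz_pow, Nat.add_sub_cancel, smul_eq_mul, smul_eq_mul, nsmul_eq_mul, smul_eq_mul]
    ring
  rw [hexp, map_mul, map_pow]
  have h1 : O.valuation (((M + 1 : ℕ) : K) * (s * D π) * r' + π * (s * D r')) ≤ 1 := by
    refine (Valuation.map_add _ _ _).trans (max_le ?_ ?_)
    · rw [map_mul, map_mul]
      calc O.valuation ((M + 1 : ℕ) : K) * O.valuation (s * D π) * O.valuation r'
          ≤ 1 * 1 * 1 := by gcongr
        _ = 1 := by rw [mul_one, mul_one]
    · rw [map_mul]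
      calc O.valuation π * O.valuation (s * D r') ≤ 1 * 1 := by gcongr
        _ = 1 := mul_one 1
  calc O.valuation π ^ M * O.valuation (((M + 1 : ℕ) : K) * (s * D π) * r' + π * (s * D r'))
      ≤ O.valuation π ^ M * 1 := by gcongr
    _ = O.valuation π ^ M := mul_one _

/-- **Arbitrarily good `p`-th-power approximations kill the derivation** (char `p`, `s • D(O) ⊆ O`, `s ≠ 0`, `O` discrete of rank one with
value-generator `π`): if for every `N` some `f` has `v (g₀ - f^p) ≤ v(π)^N · v(g₀)` (`g₀ ∈ O`), then `D g₀ = 0`. [folklore] -/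
theorem derivation_eq_zero_of_forall_approx (p : ℕ) [CharP K p] (O : ValuationSubring K) (π : K) (hπ0 : π ≠ 0)
    (hvπ : O.valuation π < 1) (harch : ∀ x : K, x ≠ 0 → ∃ n : ℕ, O.valuation π ^ n ≤ O.valuation x)
    (D : Derivation ℤ K K) (s : K) (hs : s ≠ 0) (hD : ∀ y : K, y ∈ O → s * D y ∈ O)
    (g₀ : K) (hg₀ : g₀ ∈ O) (happrox : ∀ N : ℕ, ∃ f : K, O.valuation (g₀ - f ^ p) ≤ O.valuation π ^ N * O.valuation g₀) :
    D g₀ = 0 := by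
  have hπO : π ∈ O := by rw [← O.valuation_le_one_iff]; exact hvπ.le
  have hvπpos : 0 < O.valuation π := zero_lt_iff.mpr ((Valuation.ne_zero_iff _).mpr hπ0)
  -- `D` kills `p`-th powers
  have hDp : ∀ f : K, D (f ^ p) = 0 := fun f => by
    rw [Derivation.leibniz_pow, smul_eq_mul, nsmul_eq_mul, CharP.cast_eq_zero K p, zero_mul]
  -- the bound `v (s D g₀) ≤ v π ^ (N - 1)` for every `N ≥ 1`
  have hbound : ∀ N : ℕ, 1 ≤ N → O.valuation (s * D g₀) ≤ O.valuation π ^ (N - 1) := by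
    intro N hN
    obtain ⟨f, hf⟩ := happrox N
    set r : K := g₀ - f ^ p with hr
    have hDg : D g₀ = D r := by rw [hr, map_sub, hDp, sub_zero]
    have hvr : O.valuation r ≤ O.valuation π ^ N := by
      calc O.valuation r ≤ O.valuation π ^ N * O.valuation g₀ := hf
        _ ≤ O.valuation π ^ N * 1 := by gcongr; exact (O.valuation_le_one_iff _).mpr hg₀
        _ = O.valuation π ^ N := mul_one _
    -- `r = π^N r'` with `r' ∈ O`
    have hπN : (π ^ N : K) ≠ 0 := pow_ne_zero _ hπ0
    have hr'O : r / π ^ N ∈ O := by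
      rw [← O.valuation_le_one_iff, map_div₀, map_pow]
      exact div_le_one_of_le₀ hvr zero_le
    have hrr : r = π ^ N * (r / π ^ N) := by rw [mul_div_cancel₀ _ hπN]
    rw [hDg, hrr]
    exact valuation_mul_derivation_pow_mul_le O D s hD π hπO _ hr'O N hN
  -- archimedean conclusion
  by_contra hne
  have hsD : s * D g₀ ≠ 0 := mul_ne_zero hs hne
  obtain ⟨n, hn⟩ := harch _ hsD
  have hle := hbound (n + 2) (by omega)
  rw [show n + 2 - 1 = n + 1 from rfl, pow_succ] at hle
  have hlt : O.valuation π ^ n * O.valuation π < O.valuation π ^ n * 1 :=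
    mul_lt_mul_of_pos_left hvπ (pow_pos hvπpos n)
  rw [mul_one] at hlt
  exact absurd (hn.trans hle) (not_le.mpr hlt)

/-- **A best `p`-th-power approximation exists** on a discrete rank-one valuation ring carrying a derivation `D` with bounded
denominators (`s • D(O) ⊆ O`, `s ≠ 0`) that moves `g₀ ∈ O`: some `a` approximates `g₀` at least as well as every `b`.  (Else ✓
`exists_approx_le_pow_of_forall_exists_lt` gives arbitrarily good approximations and `derivation_eq_zero_of_forall_approx` gives `D g₀ = 0`.)
This is Step 0 of the (C-div) sub-line: along a DIVISORIAL coarsening `v₁` of the composite valuation the `p`-th-power approximation of `g₀`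
terminates. [folklore] -/
theorem exists_best_pthPowerApprox_of_derivation (p : ℕ) (hp : p.Prime) [CharP K p] (O : ValuationSubring K) (π : K) (hπ0 : π ≠ 0)
    (hvπ : O.valuation π < 1) (hπ : ∀ x : K, O.valuation x < 1 → O.valuation x ≤ O.valuation π)
    (harch : ∀ x : K, x ≠ 0 → ∃ n : ℕ, O.valuation π ^ n ≤ O.valuation x)
    (D : Derivation ℤ K K) (s : K) (hs : s ≠ 0) (hD : ∀ y : K, y ∈ O → s * D y ∈ O)
    (g₀ : K) (hg₀ : g₀ ∈ O) (hDg : D g₀ ≠ 0) :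
    ∃ a : K, ∀ b : K, O.valuation (g₀ - a ^ p) ≤ O.valuation (g₀ - b ^ p) := by
  by_contra hno
  push Not at hno
  -- `hno : ∀ a, ∃ b, v (g₀ - b^p) < v (g₀ - a^p)` — no best approximation
  have happrox := exists_approx_le_pow_of_forall_exists_lt O π hπ g₀ hno hp.ne_zero
  exact hDg (derivation_eq_zero_of_forall_approx p O π hπ0 hvπ harch D s hs hD g₀ hg₀ happrox)


/-- **Dichotomy at a best approximation** (any valuation ring, characteristic `p`): if `a` approximates `g₀` by `p`-th powers at least as
well as every `b`, and `g₀ ≠ a^p`, then EITHER the value of `r := g₀ - a^p` is not the value of a `p`-th power («ramified», `e = p`), OR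
`r = c^p · u` with `u` a unit of `O` that is residually NOT a `p`-th power («inert», `f = p`): for `d ∈ O` with `u ≡ d^p (mod 𝔪_O)` the
element `b := a + c d` would be strictly better, `(a + c d)^p = a^p + c^p d^p`.  Step 1 of the (C-div) sub-line of the lead's memo. [folklore] -/
theorem bestApprox_dichotomy (p : ℕ) [hp : Fact p.Prime] [CharP K p] (O : ValuationSubring K) (g₀ a : K)
    (hbest : ∀ b : K, O.valuation (g₀ - a ^ p) ≤ O.valuation (g₀ - b ^ p)) (hne : g₀ - a ^ p ≠ 0) :
    (∀ c : K, O.valuation (c ^ p) ≠ O.valuation (g₀ - a ^ p)) ∨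
    (∃ c : K, c ≠ 0 ∧ O.valuation (c ^ p) = O.valuation (g₀ - a ^ p) ∧ (g₀ - a ^ p) / c ^ p ∈ O ∧
      O.valuation ((g₀ - a ^ p) / c ^ p) = 1 ∧ ∀ d : K, d ∈ O → ¬ O.valuation ((g₀ - a ^ p) / c ^ p - d ^ p) < 1) := by
  by_cases h : ∃ c : K, O.valuation (c ^ p) = O.valuation (g₀ - a ^ p)
  · obtain ⟨c, hc⟩ := h
    right
    have hvr : O.valuation (g₀ - a ^ p) ≠ 0 := (Valuation.ne_zero_iff _).mpr hne
    have hcp0 : c ^ p ≠ 0 := fun h0 => hvr (by rw [← hc, h0, map_zero])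
    have hc0 : c ≠ 0 := fun h0 => hcp0 (by rw [h0, zero_pow hp.out.ne_zero])
    have hvcp : 0 < O.valuation (c ^ p) := zero_lt_iff.mpr ((Valuation.ne_zero_iff _).mpr hcp0)
    have hvu : O.valuation ((g₀ - a ^ p) / c ^ p) = 1 := by rw [map_div₀, ← hc, div_self (ne_of_gt hvcp)]
    refine ⟨c, hc0, hc, (O.valuation_le_one_iff _).mp hvu.le, hvu, fun d hd hlt => ?_⟩
    -- `b := a + c d` is strictly better
    have hb := hbest (a + c * d)
    have hexp : g₀ - (a + c * d) ^ p = c ^ p * ((g₀ - a ^ p) / c ^ p - d ^ p) := by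
      rw [add_pow_char, mul_pow, mul_sub, mul_div_cancel₀ _ hcp0]; ring
    rw [hexp, map_mul] at hb
    have : O.valuation (c ^ p) * O.valuation ((g₀ - a ^ p) / c ^ p - d ^ p) < O.valuation (c ^ p) * 1 :=
      mul_lt_mul_of_pos_left hlt hvcp
    rw [mul_one] at this
    exact absurd ((hb.trans_lt this).trans_eq hc) (lt_irrefl _)
  · left
    push Not at h
    exact h

/-- **The ramified branch on a discrete rank-one valuation ring**: if no `p`-th power has the value of `r ∈ O`, `r ≠ 0`, then
`v r = v(π)^m` with `p ∤ m`. [folklore] -/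
theorem valuation_eq_pow_not_dvd_of_forall_ne (p : ℕ) (O : ValuationSubring K) (π : K)
    (hπ : ∀ x : K, O.valuation x < 1 → O.valuation x ≤ O.valuation π)
    (harch : ∀ x : K, x ≠ 0 → ∃ n : ℕ, O.valuation π ^ n ≤ O.valuation x)
    (r : K) (hr0 : r ≠ 0) (hr : r ∈ O) (hne : ∀ c : K, O.valuation (c ^ p) ≠ O.valuation r) :
    ∃ m : ℕ, O.valuation r = O.valuation π ^ m ∧ ¬ p ∣ m := by
  obtain ⟨m, hm⟩ := exists_valuation_eq_pow_of_discrete O π hπ harch r hr0 hr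
  refine ⟨m, hm, fun ⟨m', hm'⟩ => hne (π ^ m') ?_⟩
  rw [hm, hm', map_pow, map_pow, ← pow_mul, mul_comm]

end Summit.ResolutionOfSingularities.ResolutionOfSingularities.Theorems.RadicialJung.CleanModels

end
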